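import Summits.BirchSwinnertonDyer.BirchSwinnertonDyer.Theses.PrintCf2
import Summits.BirchSwinnertonDyer.Rank1Residual.P2.CMKolyvaginPointSystemOddTamagawaAtTwo
import Summits.BirchSwinnertonDyer.Rank1Residual.X11b.KolyvaginLeafInputsDischarged
import HarnessLib

/-!
# `PrintCf2.InertTwoLevelZeroPrimeHeegnerOfFactsPlus` holds (aside stmt-BirchSwinnertonDyer-28275, route PrintCf2 rev 32)

Booking rule (c) of cell `bsd-print-cf2` (PLAN §5 v1.19 (ii) / v1.32): the H₂ LEVEL-ZERO PRIME-HEEGNER ODD-MANIN sub-class theorem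
modulo print. The aside's statement is the type of ty2 g24's
`Summit.BirchSwinnertonDyer.Rank1Residual.P2.PointSystemOddTamagawa.bsdp_two_of_levelZero_primeHeegner_of_oddTamagawa_of_print`
(p640793) with the Gross 1991 Prop. 5.3 binder `h53` removed; `h53` is the kernel theorem
`Summit.BirchSwinnertonDyer.Rank1Residual.X11b.KolyvaginLeaves.h53_holds` (x11b3), exactly as cmk2-p1 g9's p640784 discharges it.
Pure plumbing: `intro`s + one `exact`. No summit statement is proved here; BSD is not proved by any of this.
-/

set_option autoImplicit false
set_option linter.dupNamespace false

namespace Summit.BirchSwinnertonDyer.BirchSwinnertonDyer.Theorems.PrintCf2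

/-- The aside `InertTwoLevelZeroPrimeHeegnerOfFactsPlus` of route `PrintCf2` (item stmt-BirchSwinnertonDyer-28275) holds:
ty2 g24's odd-Tamagawa level-zero prime-Heegner class theorem (p640793) with Gross 5.3 supplied by x11b3's `h53_holds`. -/
theorem inertTwoLevelZeroPrimeHeegnerOfFactsPlus_proof :
    Summit.BirchSwinnertonDyer.BirchSwinnertonDyer.Theses.PrintCf2.InertTwoLevelZeroPrimeHeegnerOfFactsPlus := by
  intro hmod hGZall hGZK hMilne hBF W _ _ _ hCM hin hsurj hr hT K _ _ hK hodd h3 hH q hq hd h372 Dt hopt hc β ι d₁ hy h2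
  exact Summit.BirchSwinnertonDyer.Rank1Residual.P2.PointSystemOddTamagawa.bsdp_two_of_levelZero_primeHeegner_of_oddTamagawa_of_print
    hmod hGZall hGZK hMilne hBF W hCM hin hsurj hr hT K hK hodd h3 hH hq hd h372
    (Summit.BirchSwinnertonDyer.Rank1Residual.X11b.KolyvaginLeaves.h53_holds rfl 2) Dt hopt hc β ι d₁ hy h2

end Summit.BirchSwinnertonDyer.BirchSwinnertonDyer.Theorems.PrintCf2
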